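import Summits.BirchSwinnertonDyer.Rank1Residual.P2.CountsAtTwo
import Literature.NumberTheory.EllipticCurves.Zhai2016.NonvanishingQuadraticTwists
import Literature.NumberTheory.EllipticCurves.BSDQuadraticDescentPeriodEliminationProofs
import HarnessLib

/-!
# Sub-lane «bsd-p2»: the P2 consumers of Zhai 2016 (Asian J. Math. 20) Thms 1.1 / 1.2 / 1.3 / 1.5
# (EXACT `2`-adic valuation of `L(E^{(M)},1)/Ω_∞` ⇒ `BSD(E^{(M)},2)` as an explicit finite count) and
# Thm 1.4 (Neumann–Setzer twists: `BSD(A^{(−q)},2)` CLOSED in print — a covered sub-family INSIDE the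
# open O1 cell column `r0.·.borel.·`)

HONEST FRAMING (sub-lane «bsd-p2», run/shared/lean/b2b/bsd-rank1-residual/p2/, verbatim in every
file): the target of record is the FULL Birch–Swinnerton-Dyer formula for EVERY analytic-rank `≤ 1`
`E/ℚ` at ALL primes INCLUDING `2`; the odd-prime class ledger is referee A's; the `2`-part is OPEN
(cells O1 = X5 ∖ CM and O12 = the CM corner) and under census by «bsd-p2». Census / instrument
output at `2` = EVIDENCE / conjecture items with held-out validation, NEVER a Literature fact;
certificates close PAIRS (one isogeny class, `p = 2`), never classes. This file asserts NO
arithmetic fact: its inputs are the AS-PRINTED named facts of p2-lit-1's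
`Zhai2016/NonvanishingQuadraticTwists.lean` (p313726; `thm11_…`, `thm12_…`, `thm13_…`, `thm14_…`,
`thm15_…`, nothing asserted; p2-ref GEN 8 TYPING PASS with the CURRENCY NOTE "least real period
`Ω_∞` ≠ BSD period" — honoured below: `Ω_BSD = c_∞ · Ω_∞`, `c_∞ ∈ {1, 2}` by the sign of `Δ`, which a
twist preserves) and modularity (`hasEntireLFunction_rat`, for `L(·,1) ≠ 0 ⟺ r_an = 0`); explicit
binders; NO GZK binder and NO base certificate (print gives `L ≠ 0`, finiteness of `E^{(M)}(ℚ)` and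
of `Ш(E^{(M)})`; the GZK-free bridge of `P2/TransportAtTwoShuZhai.lean` converts). Kernel shapes:
Thms 1.1/1.2/1.3/1.5 are COUNT forms (the analytic side exact in print; `BSD(·,2)` of the pair ⟺ an
explicit equation in `ord₂ #Ш`, `ord₂ ∏ c_ℓ`, `ord₂ #tor` of the twist); Thm 1.4 is a CLOSED pair
(`BSD(A^{(−q)},2)` printed). A count / closure concerns ONE pair (resp. one printed family); it never
closes a cell. Nothing booked; no mark moved. Unit `b2b-bsdres-p2-typer` GEN 2; NEW file.

## Contents

* §1 Bookkeeping: the sign of `Δ` (hence `c_∞`) is a twist invariant; Zhai's `L(WM,1) = x·Ω_∞(WM)`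
  (`IsLAlg`) reads `(x/c_∞)·Ω_BSD`; master lemma `bsdp_two_iff_of_isLAlg`: `x ≠ 0`, `E^{(M)}(ℚ)` and
  `Ш` finite ⇒ `r_an = 0` and `BSDp WM 2 ⟺ ord₂ x − ord₂ c_∞ = ord₂ #Ш + ord₂ ∏ c_ℓ − 2·ord₂ #tor`.
* §2 THM 1.1 (`Δ < 0`, `E[2](ℚ) = 0`, `ord₂ L^{alg}(E) = 0`, `M ≡ 1 (4)` with prime factors inert in the
  cubic field `F`) and THM 1.2 (`Δ > 0`, `ord₂ L^{alg}(E) = 1`, `M > 0`): in BOTH, in BSD currency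
  `ord₂(L(E^{(M)},1)/Ω_BSD) = 0` and `E^{(M)}(ℚ)[2] = 0` (twist invariance of `Irr`,
  `P2/TwistInvarianceAtTwo.lean`), so `BSDp WM 2 ⟺ ord₂ #Ш(E^{(M)}) + ord₂ ∏ c_ℓ(E^{(M)}) = 0` —
  i.e. `Ш(E^{(M)})[2] = 0` AND every Tamagawa number odd (`bsdp_two_twist_iff_of_zhai11 / 12`); cells
  `r0.·.{surj8,surjNot8,cyclic3}.·`.
* §3 THM 1.3 (`Δ < 0`, one prime `q`, `ord₂ N_q = −ord₂ L^{alg}(E) ≠ 0`) and THM 1.5 (`Δ > 0`,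
  `q ≡ 1 (4)`, `ord₂ N_q = 1 − ord₂ L^{alg}(E) ≠ 0`): `BSDp WM 2 ⟺ ord₂ #Ш + ord₂ ∏ c_ℓ = 2·ord₂ #tor`
  (`bsdp_two_twist_iff_of_zhai13 / 15`).
* §4 THM 1.4 (Neumann–Setzer `A : y² + xy = x³ + ((u−1)/4)x² + 4x + u`, `u ≡ 5 (8)`, `p = u² + 64`
  prime; `q ≡ 3 (4)` inert in `ℚ(√p)`): `BSD(A^{(−q)}, 2)` HOLDS (`bsdp_two_neumannSetzer_twist_of_zhai14`)
  — printed `pPartBSD`, finite `Ш` of odd order, rank `0`; the `2`-division cubic of `A` is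
  `(4x + u)(x² + 4)`, so `A` and all its twists have a rational point of order `2`: the pairs lie in
  the OPEN O1 cells `r0.<red>.borel.none` (image bit proved; `red`/`cm` not pinned here) — a printed
  BSD₂ closure of an infinite family (prime conductor `p = u² + 64` twisted by `−q`) needing no base
  certificate
  (contrast: the KL / CLZ / SZ transports of `P2/TransportAtTwo*.lean` are conditional on one).

References: S. Zhai, Asian J. Math. 20 (2016) 475–502, Thms 1.1–1.5 [Zhai2016]; Miller 2011 Def 1.1
[Miller2011LMS]; CLTZ 2015 §1 (1.3) [CoatesLiTianZhai2015]; HOME/p2/LIT-STATUS.md §T1 add. 5 (T1-M2).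
-/

noncomputable section

open scoped Classical MatrixGroups ModularForm

open CongruenceSubgroup NumberField WeierstrassCurve Literature.NumberTheory.EllipticCurves
  Literature.NumberTheory.EllipticCurves.ModularForms
  Literature.NumberTheory.EllipticCurves.Rank1Residual
  Literature.NumberTheory.EllipticCurves.Rank1Residual.Typed
  Literature.NumberTheory.EllipticCurves.CoatesLiTianZhai2015
  Literature.NumberTheory.EllipticCurves.Zhai2016

set_option autoImplicit false

namespace Summit.BirchSwinnertonDyer.Rank1Residual.P2

/-! ## §1 Bookkeeping: sign of `Δ`, `c_∞`, and Zhai's algebraic `L`-value in BSD currency -/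

section Bookkeeping

variable (V : WeierstrassCurve ℚ) {d : ℚ} {V' : WeierstrassCurve ℚ}

/-- The sign of the discriminant is constant along a twist model (`Δ(C • V^{(d)}) = u⁻¹²d⁶Δ(V)`,
`d ≠ 0`). [cite: SilvermanAEC2009, III.1 and X.5] -/
theorem Δ_pos_iff_of_twist (hd : d ≠ 0) (h : ∃ C : VariableChange ℚ, C • V.quadraticTwist d = V') :
    0 < V.Δ ↔ 0 < V'.Δ := by
  obtain ⟨C, rfl⟩ := h
  rw [variableChange_Δ, quadraticTwist_Δ]
  have hu : (0 : ℚ) < ((C.u⁻¹ : ℚˣ) : ℚ) ^ 12 := by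
    have := (C.u⁻¹).ne_zero
    positivity
  have h6 : (0 : ℚ) < d ^ 6 := by positivity
  rw [mul_pos_iff_of_pos_left hu, mul_pos_iff_of_pos_left h6]

/-- `c_∞ = 1` when `Δ < 0`, `c_∞ = 2` when `Δ > 0` (on a model over `ℚ`). [folklore] -/
theorem numRealComponents_eq_one_of_Δ_neg {U : WeierstrassCurve ℚ} (hΔ : U.Δ < 0) :
    (U.baseChange ℝ).numRealComponents = 1 := by
  rw [numRealComponents_baseChange_real, if_neg (not_lt.mpr hΔ.le)]

/-- `c_∞ = 2` when `Δ > 0`. [folklore] -/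
theorem numRealComponents_eq_two_of_Δ_pos {U : WeierstrassCurve ℚ} (hΔ : 0 < U.Δ) :
    (U.baseChange ℝ).numRealComponents = 2 := by
  rw [numRealComponents_baseChange_real, if_pos hΔ]

/-- **Zhai's algebraic `L`-value in BSD currency**: `L(U,1) = x · Ω_∞(U)` (`IsLAlg U x`, least real
period) reads `L^{(0)}(U,1)/0! = (x/c_∞) · Ω_BSD(U) · R` with `Ω_BSD = c_∞ · Ω_∞` (`realPeriodRat`)
and `R = 1` in rank `0`. [cite: Zhai2016, §1 (arXiv:1409.0231 chunk p0002 L12–L18)] [cite: CoatesLiTianZhai2015, §1 (1.3)] -/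
theorem leadingLCoeff_eq_of_isLAlg (U : WeierstrassCurve ℚ) [U.IsElliptic] {x : ℚ}
    (hx : IsLAlg U x) (hr : U.analyticRank = 0) (hrk : U.mordellWeilRank = 0) :
    U.leadingLCoeff = ((x / ((U.baseChange ℝ).numRealComponents : ℚ) : ℚ) : ℂ) *
      (U.realPeriodRat : ℂ) * (U.regulator : ℂ) := by
  have hc : (((U.baseChange ℝ).numRealComponents : ℚ) : ℂ) ≠ 0 := by
    exact_mod_cast (WeierstrassCurve.numRealComponents_pos (U.baseChange ℝ)).ne'
  rw [leadingLCoeff_eq_of_analyticRank_eq_zero U hr, U.regulator_eq_one_of_rank_zero hrk, hx,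
    leastRealPeriod]
  push_cast
  field_simp

/-- **MASTER LEMMA (Zhai's conclusions ⇒ the count form).** For a globally minimal elliptic `U/ℚ`
with `L(U,1) = x·Ω_∞(U)`, `x ≠ 0`, `U(ℚ)` finite and `Ш(U)` finite (the printed conclusions of Zhai
2016 Thms 1.1–1.5), granted modularity: `r_an(U) = 0` and
`BSDp U 2 ⟺ ord₂ x − ord₂ c_∞(U) = ord₂ #Ш + ord₂ ∏ c_ℓ − 2·ord₂ #U(ℚ)_tor` (GZK-free bridge).
[cite: Zhai2016, Thms. 1.1–1.5 (conclusions)] [cite: Miller2011LMS, Def. 1.1] -/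
theorem bsdp_two_iff_of_isLAlg (hmod : hasEntireLFunction_rat) (U : WeierstrassCurve ℚ)
    [U.IsElliptic] [U.IsGloballyMinimal] {x : ℚ} (hx : IsLAlg U x) (hx0 : x ≠ 0)
    (hfinPt : Finite U.toAffine.Point) [Finite U.sha] :
    U.analyticRank = 0 ∧
      (BSDp U 2 ↔ padicValRat 2 x - padicValNat 2 (U.baseChange ℝ).numRealComponents =
        (padicValNat 2 (Nat.card U.sha) : ℤ) + padicValNat 2 U.tamagawaProduct -
          2 * padicValNat 2 U.torsionOrder) := by
  have hcpos := WeierstrassCurve.numRealComponents_pos (U.baseChange ℝ)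
  have hOmega : leastRealPeriod U ≠ 0 := by
    unfold leastRealPeriod
    exact div_ne_zero U.realPeriodRat_pos_holds.ne' (by exact_mod_cast hcpos.ne')
  have hLne : U.entireLFunction 1 ≠ 0 := entireLFunction_one_ne_zero_of_isLAlg hx hx0 hOmega
  have hr : U.analyticRank = 0 := (U.analyticRank_eq_zero_iff_holds (hmod U)).2 hLne
  have hrk : U.mordellWeilRank = 0 := mordellWeilRank_eq_zero_of_finite U hfinPt
  have hL := leadingLCoeff_eq_of_isLAlg U hx hr hrk
  have hc0 : ((U.baseChange ℝ).numRealComponents : ℚ) ≠ 0 := by exact_mod_cast hcpos.ne'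
  have hx' : x / ((U.baseChange ℝ).numRealComponents : ℚ) ≠ 0 := div_ne_zero hx0 hc0
  have iff := bsdp_iff_valuation_of_leadingLCoeff U 2 (by rw [hrk, hr]) hx' hL
  rw [padicValRat.div hx0 hc0, padicValRat.of_nat] at iff
  exact ⟨hr, iff⟩

/-- `#E(ℚ)[2] = 1` (the printed `E[2](ℚ) = 0`) is `Irr W 2`. [folklore] -/
theorem irr_two_of_card_twoTorsion_eq_one (U : WeierstrassCurve ℚ) [U.IsElliptic]
    (h1 : Nat.card {P : U.toAffine.Point // (2 : ℕ) • P = 0} = 1) : Irr U 2 := by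
  rw [X5.O1.irr_two_iff_forall_two_nsmul]
  intro P hP
  haveI : Finite {P : U.toAffine.Point // (2 : ℕ) • P = 0} := Nat.finite_of_card_ne_zero (by omega)
  have hsub : Subsingleton {P : U.toAffine.Point // (2 : ℕ) • P = 0} :=
    Finite.card_le_one_iff_subsingleton.mp h1.le
  have := hsub.elim ⟨P, hP⟩ ⟨0, by simp⟩
  exact congrArg Subtype.val this

end Bookkeeping

/-! ## §2 Thm 1.1 / Thm 1.2: `E[2](ℚ) = 0`, twisting primes inert in the cubic field -/

section Irreducible

variable {W : WeierstrassCurve ℚ} [W.IsElliptic] [W.IsGloballyMinimal] [NeZero (W.conductorNorm ℤ)]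

/-- **COUNT FORM (Zhai 2016 Thm 1.1 at `2`).** Hypotheses VERBATIM as typed by p2-lit-1
(`Zhai2016.thm11_ordTwo_LAlg_twist_eq_zero`, binders): `E` `Γ₀(C)`-optimal (`Zhai2021.IsOptimalDatum`),
`Δ_E < 0`, `#E(ℚ)[2] = 1`, `ord₂(L(E,1)/Ω_∞(E)) = 0` (`x₀ ≠ 0`), `F` the cubic `2`-division field,
`M` square-free, `M ≡ 1 (4)`, `(M, C) = 1`, `r ≥ 1` odd prime factors inert in `F`, `WM` a globally
minimal model of `E^{(M)}`; modularity. Print: `ord₂(L(E^{(M)},1)/Ω_∞) = 0`, `E^{(M)}(ℚ)` and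
`Ш(E^{(M)})` finite. Here `Δ(E^{(M)}) < 0` so `Ω_BSD = Ω_∞`, and `E^{(M)}[2](ℚ) = 0` (twist invariance
of `Irr`) so `#E^{(M)}(ℚ)_tor` is odd. HENCE: `r_an(E^{(M)}) = 0` and
`BSD(E^{(M)},2) ⟺ ord₂ #Ш(E^{(M)}) + ord₂ ∏ c_ℓ(E^{(M)}) = 0` — i.e. `Ш(E^{(M)})[2] = 0` AND every
Tamagawa number of `E^{(M)}` is odd. No GZK, no base certificate. A per-pair statement.
[cite: Zhai2016, Thm. 1.1 (arXiv:1409.0231 chunk p0002 L22–L29)] [cite: Miller2011LMS, Def. 1.1] -/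
theorem bsdp_two_twist_iff_of_zhai11 (h11 : thm11_ordTwo_LAlg_twist_eq_zero)
    (hmod : hasEntireLFunction_rat) (Dt : ModularParametrizationData W (W.conductorNorm ℤ))
    (hopt : Zhai2021.IsOptimalDatum W Dt) (hΔ : W.Δ < 0)
    (h1 : Nat.card {P : W.toAffine.Point // (2 : ℕ) • P = 0} = 1)
    (hL : ∃ x : ℚ, IsLAlg W x ∧ x ≠ 0 ∧ padicValRat 2 x = 0)
    (F : Type) [Field F] [NumberField F] (hF : IsTwoDivisionField W F)
    (M : ℤ) (hsq : Squarefree M) (hM4 : M % 4 = 1) (hgcd : Int.gcd M (W.conductorNorm ℤ) = 1)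
    (hne : M.natAbs.primeFactors.Nonempty) (hin : ∀ q ∈ M.natAbs.primeFactors, q ≠ 2 ∧ IsInertIn F q)
    {WM : WeierstrassCurve ℚ} [WM.IsElliptic] [WM.IsGloballyMinimal]
    (hWM : ∃ C : VariableChange ℚ, C • W.quadraticTwist (M : ℚ) = WM) :
    WM.analyticRank = 0 ∧
      (BSDp WM 2 ↔ padicValNat 2 (Nat.card WM.sha) + padicValNat 2 WM.tamagawaProduct = 0) := by
  obtain ⟨⟨x, hx, hx0, hv⟩, -, hfinPt, hfinSha⟩ :=
    h11 W Dt hopt hΔ h1 hL F hF M hsq hM4 hgcd hne hin WM hWM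
  haveI := hfinSha
  have hM0 : (M : ℚ) ≠ 0 := by exact_mod_cast hsq.ne_zero
  -- `Δ(E^{(M)}) < 0` ⇒ `c_∞ = 1`
  have hΔM : WM.Δ < 0 := by
    have hnot : ¬ 0 < WM.Δ := fun h' => absurd ((Δ_pos_iff_of_twist W hM0 hWM).mpr h') (not_lt.mpr hΔ.le)
    exact lt_of_le_of_ne (not_lt.mp hnot) WM.isUnit_Δ.ne_zero
  have hc : (WM.baseChange ℝ).numRealComponents = 1 := numRealComponents_eq_one_of_Δ_neg hΔM
  -- `E^{(M)}[2](ℚ) = 0` ⇒ torsion odd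
  have hirr : Irr WM 2 := (irr_two_iff_of_twist W hM0 hWM).mp (irr_two_of_card_twoTorsion_eq_one W h1)
  have htor : padicValNat 2 WM.torsionOrder = 0 := padicValNat_torsionOrder_eq_zero_of_irreducible WM 2 hirr
  obtain ⟨hr, iff⟩ := bsdp_two_iff_of_isLAlg hmod WM hx hx0 hfinPt
  have h1' : padicValNat 2 1 = 0 := by simp
  rw [hv, hc, htor, h1'] at iff
  refine ⟨hr, iff.trans ?_⟩
  simp only [Nat.cast_zero, sub_zero, mul_zero]
  omega

/-- **COUNT FORM (Zhai 2016 Thm 1.2 at `2`).** As Thm 1.1 but `Δ_E > 0`, `ord₂(L(E,1)/Ω_∞(E)) = 1`,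
`M > 0`; print: `ord₂(L(E^{(M)},1)/Ω_∞) = 1`. Here `Δ(E^{(M)}) > 0` so `Ω_BSD = 2Ω_∞` and
`ord₂(L(E^{(M)},1)/Ω_BSD) = 0`; `E^{(M)}[2](ℚ) = 0`. HENCE `r_an(E^{(M)}) = 0` and
`BSD(E^{(M)},2) ⟺ ord₂ #Ш(E^{(M)}) + ord₂ ∏ c_ℓ(E^{(M)}) = 0` (printed remark p0003 L46–L47: "entirely
consistent with the 2-part of BSD, provided … the 2-primary subgroup of Ш … is zero" — the count
names the other proviso: odd Tamagawa numbers). No GZK, no base certificate.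
[cite: Zhai2016, Thm. 1.2 (arXiv:1409.0231 chunk p0003 L11–L18, L46–L47)] [cite: Miller2011LMS, Def. 1.1] -/
theorem bsdp_two_twist_iff_of_zhai12 (h12 : thm12_ordTwo_LAlg_twist_eq_one)
    (hmod : hasEntireLFunction_rat) (Dt : ModularParametrizationData W (W.conductorNorm ℤ))
    (hopt : Zhai2021.IsOptimalDatum W Dt) (hΔ : 0 < W.Δ)
    (h1 : Nat.card {P : W.toAffine.Point // (2 : ℕ) • P = 0} = 1)
    (hL : ∃ x : ℚ, IsLAlg W x ∧ x ≠ 0 ∧ padicValRat 2 x = 1)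
    (F : Type) [Field F] [NumberField F] (hF : IsTwoDivisionField W F)
    (M : ℤ) (hMpos : 0 < M) (hsq : Squarefree M) (hM4 : M % 4 = 1)
    (hgcd : Int.gcd M (W.conductorNorm ℤ) = 1)
    (hne : M.natAbs.primeFactors.Nonempty) (hin : ∀ q ∈ M.natAbs.primeFactors, q ≠ 2 ∧ IsInertIn F q)
    {WM : WeierstrassCurve ℚ} [WM.IsElliptic] [WM.IsGloballyMinimal]
    (hWM : ∃ C : VariableChange ℚ, C • W.quadraticTwist (M : ℚ) = WM) :
    WM.analyticRank = 0 ∧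
      (BSDp WM 2 ↔ padicValNat 2 (Nat.card WM.sha) + padicValNat 2 WM.tamagawaProduct = 0) := by
  obtain ⟨⟨x, hx, hx0, hv⟩, -, hfinPt, hfinSha⟩ :=
    h12 W Dt hopt hΔ h1 hL F hF M hMpos hsq hM4 hgcd hne hin WM hWM
  haveI := hfinSha
  have hM0 : (M : ℚ) ≠ 0 := by exact_mod_cast hsq.ne_zero
  have hΔM : 0 < WM.Δ := (Δ_pos_iff_of_twist W hM0 hWM).mp hΔ
  have hc : (WM.baseChange ℝ).numRealComponents = 2 := numRealComponents_eq_two_of_Δ_pos hΔM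
  have hirr : Irr WM 2 := (irr_two_iff_of_twist W hM0 hWM).mp (irr_two_of_card_twoTorsion_eq_one W h1)
  have htor : padicValNat 2 WM.torsionOrder = 0 := padicValNat_torsionOrder_eq_zero_of_irreducible WM 2 hirr
  obtain ⟨hr, iff⟩ := bsdp_two_iff_of_isLAlg hmod WM hx hx0 hfinPt
  rw [hv, hc, htor] at iff
  refine ⟨hr, iff.trans ?_⟩
  have h2 : padicValNat 2 2 = 1 := by simp
  simp only [h2, Nat.cast_one, Nat.cast_zero, sub_self, mul_zero, sub_zero]
  omega

omit [W.IsGloballyMinimal] [NeZero (W.conductorNorm ℤ)] in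
/-- **Grid placement for Thm 1.1 / 1.2**: the twist has rank bit `r0` and image bit `≠ borel`
(`E[2](ℚ) = 0` on the base, twist invariance of `Irr`). [cite: Zhai2016, Thms. 1.1–1.2 (setting)] -/
theorem cell_twist_of_zhai11_12 (hmod : hasEntireLFunction_rat)
    (h1 : Nat.card {P : W.toAffine.Point // (2 : ℕ) • P = 0} = 1) {M : ℤ} (hM : M ≠ 0)
    {WM : WeierstrassCurve ℚ} [WM.IsElliptic] [WM.IsGloballyMinimal]
    (hWM : ∃ C : VariableChange ℚ, C • W.quadraticTwist (M : ℚ) = WM)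
    (hLne : WM.entireLFunction 1 ≠ 0) :
    (cellAtTwoOf WM).r1 = false ∧ (cellAtTwoOf WM).img ≠ .borel := by
  have hr : WM.analyticRank = 0 := (WM.analyticRank_eq_zero_iff_holds (hmod WM)).2 hLne
  refine ⟨?_, img_ne_borel_of_twist_of_forall_two_nsmul W
    ((X5.O1.irr_two_iff_forall_two_nsmul W).mp (irr_two_of_card_twoTorsion_eq_one W h1))
    (by exact_mod_cast hM) hWM⟩
  show decide (WM.analyticRank = 1) = false
  rw [decide_eq_false_iff_not]; omega

end Irreducible

/-! ## §3 Thm 1.3 / Thm 1.5: one twisting prime with `ord₂ N_q` matched to `ord₂ L^{alg}(E)` -/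

section OnePrime

variable {W : WeierstrassCurve ℚ} [W.IsElliptic] [W.IsGloballyMinimal] [NeZero (W.conductorNorm ℤ)]

/-- **COUNT FORM (Zhai 2016 Thm 1.3 at `2`).** Hypotheses VERBATIM as typed (binders): `E`
`Γ₀(C)`-optimal, `Δ_E < 0`, `L(E,1) ≠ 0` with algebraic value `x₀`, `q` an odd prime of good
reduction with `ord₂ N_q = −ord₂ x₀ ≠ 0`, `M = ±q ≡ 1 (4)`, `WM` a globally minimal model of `E^{(M)}`;
modularity. Print: `ord₂(L(E^{(M)},1)/Ω_∞) = 0`, finiteness. `Δ(E^{(M)}) < 0` ⇒ `Ω_BSD = Ω_∞`. HENCE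
`r_an(E^{(M)}) = 0` and `BSD(E^{(M)},2) ⟺ ord₂ #Ш(E^{(M)}) + ord₂ ∏ c_ℓ(E^{(M)}) = 2·ord₂ #E^{(M)}(ℚ)_tor`.
[cite: Zhai2016, Thm. 1.3 (arXiv:1409.0231 chunk p0003 L51–L58)] [cite: Miller2011LMS, Def. 1.1] -/
theorem bsdp_two_twist_iff_of_zhai13 (h13 : thm13_ordTwo_LAlg_primeTwist_eq_zero)
    (hmod : hasEntireLFunction_rat) (Dt : ModularParametrizationData W (W.conductorNorm ℤ))
    (hopt : Zhai2021.IsOptimalDatum W Dt) (hΔ : W.Δ < 0) (hLW : W.entireLFunction 1 ≠ 0)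
    (x₀ : ℚ) (hx₀ : IsLAlg W x₀) (q : ℕ) (hq : q.Prime) (hq2 : q ≠ 2)
    (hqC : ¬ q ∣ W.conductorNorm ℤ)
    (hNq : (padicValNat 2 (W.reductionPointCount q) : ℤ) = -padicValRat 2 x₀)
    (hNq0 : padicValNat 2 (W.reductionPointCount q) ≠ 0)
    (M : ℤ) (hM : M = q ∨ M = -q) (hM4 : M % 4 = 1)
    {WM : WeierstrassCurve ℚ} [WM.IsElliptic] [WM.IsGloballyMinimal]
    (hWM : ∃ C : VariableChange ℚ, C • W.quadraticTwist (M : ℚ) = WM) :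
    WM.analyticRank = 0 ∧
      (BSDp WM 2 ↔ padicValNat 2 (Nat.card WM.sha) + padicValNat 2 WM.tamagawaProduct =
        2 * padicValNat 2 WM.torsionOrder) := by
  obtain ⟨⟨x, hx, hx0, hv⟩, -, hfinPt, hfinSha⟩ :=
    h13 W Dt hopt hΔ hLW x₀ hx₀ q hq hq2 hqC hNq hNq0 M hM hM4 WM hWM
  haveI := hfinSha
  have hM0 : (M : ℚ) ≠ 0 := by
    have : (q : ℤ) ≠ 0 := by exact_mod_cast hq.ne_zero
    rcases hM with rfl | rfl <;> push_cast <;> [exact_mod_cast this; exact neg_ne_zero.mpr (by exact_mod_cast this)]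
  have hΔM : WM.Δ < 0 := by
    have hnot : ¬ 0 < WM.Δ := fun h' => absurd ((Δ_pos_iff_of_twist W hM0 hWM).mpr h') (not_lt.mpr hΔ.le)
    exact lt_of_le_of_ne (not_lt.mp hnot) WM.isUnit_Δ.ne_zero
  have hc : (WM.baseChange ℝ).numRealComponents = 1 := numRealComponents_eq_one_of_Δ_neg hΔM
  obtain ⟨hr, iff⟩ := bsdp_two_iff_of_isLAlg hmod WM hx hx0 hfinPt
  have h1 : padicValNat 2 1 = 0 := by simp
  rw [hv, hc, h1] at iff
  refine ⟨hr, iff.trans ?_⟩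
  simp only [Nat.cast_zero, sub_zero]
  omega

/-- **COUNT FORM (Zhai 2016 Thm 1.5 at `2`).** Hypotheses VERBATIM as typed (binders): `E`
`Γ₀(C)`-optimal, `Δ_E > 0`, `L(E,1) ≠ 0` with algebraic value `x₀`, `q ≡ 1 (4)` a prime of good
reduction with `ord₂ N_q = 1 − ord₂ x₀ ≠ 0`, `WM` a globally minimal model of `E^{(q)}`; modularity.
Print: `ord₂(L(E^{(q)},1)/Ω_∞) = 1`, finiteness. `Δ(E^{(q)}) > 0` ⇒ `Ω_BSD = 2Ω_∞`. HENCE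
`r_an(E^{(q)}) = 0` and `BSD(E^{(q)},2) ⟺ ord₂ #Ш(E^{(q)}) + ord₂ ∏ c_ℓ(E^{(q)}) = 2·ord₂ #E^{(q)}(ℚ)_tor`.
[cite: Zhai2016, Thm. 1.5 (arXiv:1409.0231 chunk p0003 L105–L110, p0004 L1)] [cite: Miller2011LMS, Def. 1.1] -/
theorem bsdp_two_twist_iff_of_zhai15 (h15 : thm15_ordTwo_LAlg_primeTwist_eq_one)
    (hmod : hasEntireLFunction_rat) (Dt : ModularParametrizationData W (W.conductorNorm ℤ))
    (hopt : Zhai2021.IsOptimalDatum W Dt) (hΔ : 0 < W.Δ) (hLW : W.entireLFunction 1 ≠ 0)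
    (x₀ : ℚ) (hx₀ : IsLAlg W x₀) (q : ℕ) (hq : q.Prime) (hq4 : q % 4 = 1)
    (hqC : ¬ q ∣ W.conductorNorm ℤ)
    (hNq : (padicValNat 2 (W.reductionPointCount q) : ℤ) = 1 - padicValRat 2 x₀)
    (hNq0 : padicValNat 2 (W.reductionPointCount q) ≠ 0)
    {WM : WeierstrassCurve ℚ} [WM.IsElliptic] [WM.IsGloballyMinimal]
    (hWM : ∃ C : VariableChange ℚ, C • W.quadraticTwist (q : ℚ) = WM) :
    WM.analyticRank = 0 ∧
      (BSDp WM 2 ↔ padicValNat 2 (Nat.card WM.sha) + padicValNat 2 WM.tamagawaProduct =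
        2 * padicValNat 2 WM.torsionOrder) := by
  obtain ⟨⟨x, hx, hx0, hv⟩, -, hfinPt, hfinSha⟩ :=
    h15 W Dt hopt hΔ hLW x₀ hx₀ q hq hq4 hqC hNq hNq0 WM hWM
  haveI := hfinSha
  have hq0 : (q : ℚ) ≠ 0 := by exact_mod_cast hq.ne_zero
  have hΔM : 0 < WM.Δ := (Δ_pos_iff_of_twist W hq0 hWM).mp hΔ
  have hc : (WM.baseChange ℝ).numRealComponents = 2 := numRealComponents_eq_two_of_Δ_pos hΔM
  obtain ⟨hr, iff⟩ := bsdp_two_iff_of_isLAlg hmod WM hx hx0 hfinPt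
  rw [hv, hc] at iff
  refine ⟨hr, iff.trans ?_⟩
  have h2 : padicValNat 2 2 = 1 := by simp
  simp only [h2, Nat.cast_one, sub_self]
  omega

end OnePrime

/-! ## §4 Thm 1.4: the Neumann–Setzer twists — `BSD(A^{(−q)},2)` closed in print, inside open O1 cells -/

section NeumannSetzer

/-- For `u ≡ 1 (mod 4)` the Neumann–Setzer model is an elliptic curve (`Δ = −(u² + 64)² ≠ 0`).
[cite: Zhai2016, §1 (arXiv:1409.0231 chunk p0003 L60–L64)] -/
theorem isElliptic_neumannSetzer {u : ℤ} (hu : u % 4 = 1) : (neumannSetzer u).IsElliptic := by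
  rw [WeierstrassCurve.isElliptic_iff, neumannSetzer_Δ u hu, isUnit_iff_ne_zero]
  have : (0 : ℚ) < (u : ℚ) ^ 2 + 64 := by positivity
  exact neg_ne_zero.mpr (pow_ne_zero 2 this.ne')

/-- **The Neumann–Setzer curve has a rational point of order `2`**: its `2`-division cubic is
`4x³ + u x² + 16x + 4u = (4x + u)(x² + 4)` (`b₂ = u`, `b₄ = 8`, `b₆ = 4u` for `u ≡ 1 (4)`), with the
rational root `x = −u/4` (`red_two_iff_exists_fourCubic_root`).
[cite: Zhai2016, §1 (chunk p0003 L60–L64) and §4 (the 2-isogeny used for the 2-descent)] -/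
theorem red_two_neumannSetzer {u : ℤ} (hu : u % 4 = 1) :
    haveI := isElliptic_neumannSetzer hu
    Red (neumannSetzer u) 2 := by
  haveI := isElliptic_neumannSetzer hu
  rw [red_two_iff_exists_fourCubic_root]
  obtain ⟨k, rfl⟩ : ∃ k : ℤ, u = 4 * k + 1 := ⟨(u - 1) / 4, by omega⟩
  have hk' : (4 * k + 1 - 1) / 4 = k := by omega
  refine ⟨-((4 * k + 1 : ℤ) : ℚ) / 4, ?_⟩
  simp only [neumannSetzer, hk', WeierstrassCurve.b₂, WeierstrassCurve.b₄, WeierstrassCurve.b₆]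
  push_cast
  ring

/-- **`BSD(A^{(−q)}, 2)` HOLDS on the Neumann–Setzer twists of Zhai 2016 Thm 1.4** (hypotheses
VERBATIM as typed by p2-lit-1, binders: `u ≡ 5 (mod 8)`, `p = u² + 64` prime, `q ≡ 3 (mod 4)` prime
inert in `ℚ(√p)`, `WM` a globally minimal model of `A^{(−q)}`; modularity). Print gives the `2`-part of
BSD (`pPartBSD WM 2`), `L(A^{(−q)},1) ≠ 0`, `A^{(−q)}(ℚ)` finite, `Ш` finite of odd order; the GZK-free
bridge turns the printed `2`-part into Miller's `BSDp WM 2` (rank `0 = r_an` from finiteness +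
modularity). A CLOSED PAIR for every such `(u, q)` — a printed sub-family of the open O1 cells, no base
certificate needed; it closes no cell. [cite: Zhai2016, Thm. 1.4 (arXiv:1409.0231 chunk p0003 L60–L75)] [cite: Miller2011LMS, Def. 1.1] -/
theorem bsdp_two_neumannSetzer_twist_of_zhai14 (h14 : thm14_neumannSetzer_twists)
    (hmod : hasEntireLFunction_rat) (u : ℤ) (hu : u % 8 = 5) (hp : (u ^ 2 + 64).natAbs.Prime)
    (q : ℕ) (hq : q.Prime) (hq4 : q % 4 = 3) (hin : CaiLiZhai2019.IsInertIn q (u ^ 2 + 64))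
    {WM : WeierstrassCurve ℚ} [WM.IsElliptic] [WM.IsGloballyMinimal]
    (hWM : ∃ C : VariableChange ℚ, C • (neumannSetzer u).quadraticTwist (-(q : ℚ)) = WM) :
    WM.analyticRank = 0 ∧ BSDp WM 2 := by
  obtain ⟨⟨x, hx, hx0, -⟩, hLne, hfinPt, hfinSha, -, hPB⟩ := h14 u hu hp q hq hq4 hin WM hWM
  haveI := hfinSha
  have hr : WM.analyticRank = 0 := (WM.analyticRank_eq_zero_iff_holds (hmod WM)).2 hLne
  have hrk : WM.mordellWeilRank = 0 := mordellWeilRank_eq_zero_of_finite WM hfinPt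
  exact ⟨hr, bsdp_of_pPart_of_finite WM 2 hmod (by rw [hrk, hr]) ((pPartBSD_iff_pPart WM 2).1 hPB)⟩

/-- **Where the Neumann–Setzer pairs sit: rank bit `r0`, image bit `borel`** (a rational `2`-torsion
point on `A`, twist invariance of `Red` at `2`): cells `r0.<red>.borel.<cm>`; with `A` non-CM of odd
prime conductor these are the OPEN O1 cells `r0.goodOrd.borel.none` (the `red`/`cm` bits are not
proved here). [cite: Zhai2016, Thm. 1.4 (setting)] -/
theorem cell_neumannSetzer_twist_of_zhai14 (h14 : thm14_neumannSetzer_twists)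
    (hmod : hasEntireLFunction_rat) (u : ℤ) (hu : u % 8 = 5) (hp : (u ^ 2 + 64).natAbs.Prime)
    (q : ℕ) (hq : q.Prime) (hq4 : q % 4 = 3) (hin : CaiLiZhai2019.IsInertIn q (u ^ 2 + 64))
    {WM : WeierstrassCurve ℚ} [WM.IsElliptic] [WM.IsGloballyMinimal]
    (hWM : ∃ C : VariableChange ℚ, C • (neumannSetzer u).quadraticTwist (-(q : ℚ)) = WM) :
    (cellAtTwoOf WM).r1 = false ∧ (cellAtTwoOf WM).img = .borel := by
  have hu4 : u % 4 = 1 := by omega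
  haveI := isElliptic_neumannSetzer hu4
  have hr := (bsdp_two_neumannSetzer_twist_of_zhai14 h14 hmod u hu hp q hq hq4 hin hWM).1
  have hq0 : (-(q : ℚ)) ≠ 0 := neg_ne_zero.mpr (by exact_mod_cast hq.ne_zero)
  refine ⟨?_, ?_⟩
  · show decide (WM.analyticRank = 1) = false
    rw [decide_eq_false_iff_not]; omega
  · rw [cellAtTwoOf_img, imgAtTwoOf_eq_borel_iff]
    exact (red_two_iff_of_twist (neumannSetzer u) hq0 hWM).mp (red_two_neumannSetzer hu4)

end NeumannSetzer

end Summit.BirchSwinnertonDyer.Rank1Residual.P2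

end
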